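import Summits.AnomalousDissipation.AnomalousDissipation.Theorems.CubicParityLoud.Negative.Clauses

/-!
# Crux-ideate sketch for `MomentParity.UniformResolution` (stmt-AnomalousDissipation-14330), ideator 1, round 1

First-lemma signatures for the idea cards (they need not be proved here; they must elaborate).

* Card A (`enstrophy-ui-localized-tail-budget`): `TailBudgetDichotomy`, `TightnessInProbability`,
  `ResolutionIffUI`, the transfer statement `LoudUI` and the composition shape `LineShapeA`.
* Card B (`shell-third-moment-flux-locality`): `FluxLocalityResolution`, `LoudShellDecay`, `LineShapeB`.
-/

noncomputable section

-- `Summit.<Summit>.<Problem>` duplicate namespace is the tree's mandated layout for single-conjunct summits.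
set_option linter.dupNamespace false

namespace Summit.AnomalousDissipation.AnomalousDissipation.Cruxes.UniformResolution.IdeateOne

open MeasureTheory Filter Topology UnitAddTorus
open scoped ENNReal
open Literature.Analysis.FunctionSpaces Literature.Analysis.FluidPDE
open Summit.AnomalousDissipation.AnomalousDissipation.Theses.MomentParity
open Summit.AnomalousDissipation.AnomalousDissipation.Theorems.CubicParityLoud.Negative

/-! ## Vocabulary -/

/-- All-degree polynomial stationarity at level `N` (the `d = ∞` rung; on compactly supported level-`N`
laws this is Liouville invariance for Galerkin NS at `(ν, P_N f)`). -/
def IsPolyStationary (ν : ℝ) (f : T3 → R3) (N : ℕ) (μ : Measure H3) : Prop :=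
  ∀ (m : ℕ) (g : Fin m → T3 → R3) (P : MvPolynomial (Fin m) ℝ), (∀ i, IsBandTest N (g i)) →
    Integrable (fun u => Torus.nsGeneratorPairing ν f u (polyGrad g P u)) μ ∧
      ∫ u, Torus.nsGeneratorPairing ν f u (polyGrad g P u) ∂μ = 0

/-- Spectral enstrophy `Z(u) = ‖∇u‖₂²` of `u ∈ H`. -/
def enst (u : H3) : ℝ≥0∞ := Torus.eGradNormSq (u.1 : T3 → R3)

/-- Resolved enstrophy `‖∇P_κ u‖₂²`. -/
def enstLow (κ : ℕ) (u : H3) : ℝ≥0∞ := Torus.eGradNormSq (Torus.fourierTruncate κ (u.1 : T3 → R3))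

/-- An invariant (all-degree stationary) level-`N` Galerkin law carried by the ball `‖u‖ ≤ R`. -/
def IsInvariantLevelLaw (ν : ℝ) (f : T3 → R3) (N : ℕ) (R : ℝ) (μ : Measure H3) : Prop :=
  IsProbabilityMeasure μ ∧ (∀ᵐ u ∂μ, IsLevel N u) ∧ (∀ᵐ u ∂μ, ‖u‖ ≤ R) ∧ IsPolyStationary ν f N μ

/-- The resolution clause of the crux (verbatim shape): `∫ Z ≤ ∫ ‖∇P_{κ n}u‖² + 1/(n+1)` for all `n`. -/
def ResClause (κ : ℕ → ℕ) (μ : Measure H3) : Prop :=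
  ∀ n : ℕ, ∫⁻ u, enst u ∂μ ≤ (∫⁻ u, enstLow (κ n) u ∂μ) + ((n : ℝ≥0∞) + 1)⁻¹

/-- Uniform-integrability clause with threshold schedule `G`: the enstrophy carried by the bursts
`{Z ≥ G n}` is at most `1/(n+1)`. -/
def UIClause (G : ℕ → ℕ) (μ : Measure H3) : Prop :=
  ∀ n : ℕ, ∫⁻ u in {u : H3 | ((G n : ℕ) : ℝ≥0∞) ≤ enst u}, enst u ∂μ ≤ ((n : ℝ≥0∞) + 1)⁻¹

/-! ## Card A — the localized tail budget: resolution ⟺ uniform integrability of enstrophy -/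

/-- **First lemma (Card A).** LOCALIZED TAIL-ENERGY BUDGET. For every invariant level-`N` law in the
ball of radius `R` at viscosity `ν`, every cutoff `κ` and every `θ ∈ (0,1]`:
`E‖∇u‖² ≤ E‖∇P_κ u‖² + Cθ + E[Z ; Z ≥ θ²ν²κ/C]`, with `C = C(f, ν, R)` independent of `N`, `κ`, `θ`.
(Stationarity of `|Q_κ u|² χ(Z/G²)` with `G² = θ²ν²κ/c²`; Bernstein bounds for the flux on the calm
region; Foias–Guillopé–Temam layer bound `ν E[‖Au‖²/(1+Z)²] ≤ C` from stationarity of `-(1+Z)⁻¹`;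
the critical cancellation `G⁴/κ² = θ⁴ν⁴/c⁴` is beaten by the free parameter `θ`.) -/
def TailBudgetDichotomy : Prop :=
  ∀ f : T3 → R3, Torus.IsSmooth f → Torus.IsDivFree f → Torus.HasZeroMean f →
    ∀ ν R : ℝ, 0 < ν → ∃ C : ℝ, 0 < C ∧ ∀ θ : ℝ, 0 < θ → θ ≤ 1 →
      ∀ (N κ : ℕ) (μ : Measure H3), IsInvariantLevelLaw ν f N R μ →
        ∫⁻ u, enst u ∂μ ≤ (∫⁻ u, enstLow κ u ∂μ) + ENNReal.ofReal (C * θ) +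
          ∫⁻ u in {u : H3 | ENNReal.ofReal (θ ^ 2 * ν ^ 2 * κ / C) ≤ enst u}, enst u ∂μ

/-- **Corollary 1 (provable from the first lemma + Chebyshev).** TIGHTNESS IN PROBABILITY of the
enstrophy spectrum for EVERY invariant level-`N` family in a fixed ball at fixed `ν`, uniformly in `N`:
typical states are resolved; only rare bursts can hold a leak. -/
def TightnessInProbability : Prop :=
  ∀ f : T3 → R3, Torus.IsSmooth f → Torus.IsDivFree f → Torus.HasZeroMean f →
    ∀ ν R η δ : ℝ, 0 < ν → 0 < η → 0 < δ → ∃ κ : ℕ,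
      ∀ (N : ℕ) (μ : Measure H3), IsInvariantLevelLaw ν f N R μ →
        μ {u : H3 | ENNReal.ofReal η ≤ enst u - enstLow κ u} ≤ ENNReal.ofReal δ

/-- **Corollary 2 (provable from the first lemma).** N-uniform resolution ⟺ N-uniform uniform
integrability of the enstrophy, for invariant level-`N` families in a fixed ball at fixed `ν`
(schedules converted explicitly in both directions). -/
def ResolutionIffUI : Prop :=
  ∀ f : T3 → R3, Torus.IsSmooth f → Torus.IsDivFree f → Torus.HasZeroMean f →
    ∀ ν R : ℝ, 0 < ν →
      (∀ G : ℕ → ℕ, ∃ κ : ℕ → ℕ, ∀ (N : ℕ) (μ : Measure H3), IsInvariantLevelLaw ν f N R μ →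
          UIClause G μ → ResClause κ μ) ∧
      (∀ κ : ℕ → ℕ, ∃ G : ℕ → ℕ, ∀ (N : ℕ) (μ : Measure H3), IsInvariantLevelLaw ν f N R μ →
          ResClause κ μ → UIClause G μ)

/-- **Transfer (Card A): `C⁺ = LoudUI`.** From a loud invariant family (the `d = ∞` form of the crux's
hypothesis, reached by `MomentClosure`) extract a loud invariant family whose ENSTROPHY IS UNIFORMLY
INTEGRABLE, budgets degraded to `(E', ε')` uniformly in `j`. Equivalent to the crux given
`ResolutionIffUI` and `MomentClosure`. -/
def LoudUI : Prop :=
  ∀ f : T3 → R3, Torus.IsSmooth f → Torus.IsDivFree f → Torus.HasZeroMean f →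
    ∀ (ν : ℕ → ℝ) (E ε : ℝ), (∀ j, 0 < ν j) → Tendsto ν atTop (𝓝 0) → 0 < ε →
      (∀ j : ℕ, ∃ R : ℝ, ∃ᶠ N in atTop, ∃ μ : Measure H3, IsInvariantLevelLaw (ν j) f N R μ ∧
          Torus.ensembleEnergy μ ≤ E ∧ ε ≤ Torus.ensembleDissipation (ν j) μ) →
      ∃ E' ε' : ℝ, 0 < ε' ∧ ∀ j : ℕ, ∃ (R : ℝ) (G : ℕ → ℕ), ∃ᶠ N in atTop, ∃ μ : Measure H3,
        IsInvariantLevelLaw (ν j) f N R μ ∧ UIClause G μ ∧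
          Torus.ensembleEnergy μ ≤ E' ∧ ε' ≤ Torus.ensembleDissipation (ν j) μ

/-- Composition shape of line A (to be cut into stubs at crux-plan): closure in `d`, the dichotomy,
the bet, conclude the crux BY NAME. -/
def LineShapeA : Prop := MomentClosure → TailBudgetDichotomy → ResolutionIffUI → LoudUI → UniformResolution

/-! ## Card B — flux locality in the mean: per-shell third moments -/

/-- Dyadic shell energy `e_q(u) = Σ_{2^q < |k| ≤ 2^{q+1}} ‖û(k)‖²` (a real polynomial of degree 2 on `H`). -/
def shellEnergy (q : ℕ) (u : H3) : ℝ :=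
  ∑ k ∈ Torus.freqBall (2 ^ (q + 1)) \ Torus.freqBall (2 ^ q),
    ‖mFourierCoeff (EuclideanSpace.complexify ∘ (u.1 : T3 → R3)) k‖ ^ 2

/-- Third-moment shell decay with constants `(A, η)`: `E[e_q^{3/2}] ≤ A · 2^{-(5/2+η) q}` for all `q`
(temporal flatness of shell energies growing slower than `k^{1/2}`). -/
def ShellThirdMomentBound (A η : ℝ) (μ : Measure H3) : Prop :=
  ∀ q : ℕ, ∫ u, shellEnergy q u ^ (3 / 2 : ℝ) ∂μ ≤ A * (2 : ℝ) ^ (-(5 / 2 + η) * q)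

/-- **First lemma (Card B).** FLUX LOCALITY IN THE MEAN: the tail identity
`ν E‖∇Q_κ u‖² = E(Q_κ f, u) + E[e_κ(u)]` plus the Cheskidov–Constantin–Friedlander–Shvydkoy dyadic
locality of the flux and Bernstein `‖Δ_q u‖₃³ ≤ c 2^{3q/2} ‖Δ_q u‖₂³` give, under the shell bound,
`E‖∇u‖² ≤ E‖∇P_{2^Q} u‖² + (C A 2^{-ηQ} + R ‖Q_{2^Q} f‖₂)/ν`, uniformly in `N`. -/
def FluxLocalityResolution : Prop :=
  ∀ η : ℝ, 0 < η → η < 2 / 3 → ∃ C : ℝ, 0 < C ∧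
    ∀ f : T3 → R3, Torus.IsSmooth f → Torus.IsDivFree f → Torus.HasZeroMean f →
      ∀ ν R A : ℝ, 0 < ν → 0 ≤ A → ∀ (N Q : ℕ) (μ : Measure H3), IsInvariantLevelLaw ν f N R μ →
        ShellThirdMomentBound A η μ →
          ∫⁻ u, enst u ∂μ ≤ (∫⁻ u, enstLow (2 ^ Q) u ∂μ) +
            ENNReal.ofReal ((C * A * (2 : ℝ) ^ (-(η * Q)) +
              R * Real.sqrt (∫ x, ‖f x - Torus.fourierTruncate (2 ^ Q) f x‖ ^ 2)) / ν)

/-- **Transfer (Card B): `C⁺ = LoudShellDecay`.** Some loud invariant family has third shell moments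
decaying like `2^{-(5/2+η)q}` with `(A_j, η_j)` uniform in `N` (free in `j`). -/
def LoudShellDecay : Prop :=
  ∀ f : T3 → R3, Torus.IsSmooth f → Torus.IsDivFree f → Torus.HasZeroMean f →
    ∀ (ν : ℕ → ℝ) (E ε : ℝ), (∀ j, 0 < ν j) → Tendsto ν atTop (𝓝 0) → 0 < ε →
      (∀ j : ℕ, ∃ R : ℝ, ∃ᶠ N in atTop, ∃ μ : Measure H3, IsInvariantLevelLaw (ν j) f N R μ ∧
          Torus.ensembleEnergy μ ≤ E ∧ ε ≤ Torus.ensembleDissipation (ν j) μ) →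
      ∃ E' ε' : ℝ, 0 < ε' ∧ ∀ j : ℕ, ∃ (R A η : ℝ), 0 < η ∧ η < 2 / 3 ∧ ∃ᶠ N in atTop, ∃ μ : Measure H3,
        IsInvariantLevelLaw (ν j) f N R μ ∧ ShellThirdMomentBound A η μ ∧
          Torus.ensembleEnergy μ ≤ E' ∧ ε' ≤ Torus.ensembleDissipation (ν j) μ

/-! ### Card B, sharp form: the mean local flux `F_q = 2^q E[‖u_q‖_∞ ‖u_q‖₂²]` -/

/-- The dyadic block `u_q = P_{2^{q+1}} u - P_{2^q} u` of `u ∈ H` as a field on `T³` (a trigonometric polynomial). -/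
def shellBlock (q : ℕ) (u : H3) : T3 → R3 := fun x =>
  Torus.fourierTruncate (2 ^ (q + 1)) (u.1 : T3 → R3) x - Torus.fourierTruncate (2 ^ q) (u.1 : T3 → R3) x

/-- MEAN LOCAL FLUX at shell `q`: `F_q(μ) = 2^q ∫ ‖u_q‖_{L^∞} · ‖u_q‖₂² dμ` (an upper bound for the mean energy transfer through
shell `q` carried by local triads: `|Π_q| ≲ 2^q ‖u_q‖₃³ ≤ 2^q ‖u_q‖_∞ ‖u_q‖₂²`). -/
def meanLocalFlux (q : ℕ) (μ : Measure H3) : ℝ≥0∞ :=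
  (2 : ℝ≥0∞) ^ q * ∫⁻ u, eLpNorm (shellBlock q u) ⊤ volume * ENNReal.ofReal (shellEnergy q u) ∂μ

/-- **First lemma (Card B, sharp form).** FLUX LOCALITY IN THE MEAN: for every invariant level-`N` law in a ball at viscosity `ν`
and every dyadic cutoff `2^Q`, the unresolved enstrophy is bounded by a two-sided geometrically weighted sum of mean local fluxes
plus the force tail: `E‖∇u‖² ≤ E‖∇P_{2^Q}u‖² + (C Σ_q 2^{-a|q-Q|} F_q(μ) + R‖Q_{2^Q} f‖₂)/ν` with absolute constants `C, a > 0`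
(CCFS dyadic locality of the flux, taken inside the expectation; the tail row of the crux's test class). -/
def MeanFluxLocality : Prop :=
  ∃ C a : ℝ, 0 < C ∧ 0 < a ∧
    ∀ f : T3 → R3, Torus.IsSmooth f → Torus.IsDivFree f → Torus.HasZeroMean f →
      ∀ ν R : ℝ, 0 < ν → ∀ (N Q : ℕ) (μ : Measure H3), IsInvariantLevelLaw ν f N R μ →
        ∫⁻ u, enst u ∂μ ≤ (∫⁻ u, enstLow (2 ^ Q) u ∂μ) +
          (ENNReal.ofReal (C / ν) * ∑' q : ℕ, ENNReal.ofReal ((2 : ℝ) ^ (-(a * |(q : ℝ) - Q|))) * meanLocalFlux q μ) +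
            ENNReal.ofReal (R * Real.sqrt (∫ x, ‖f x - Torus.fourierTruncate (2 ^ Q) f x‖ ^ 2) / ν)

/-- Spatial currency: BERNSTEIN UNSATURATION at intermittency level `d` in the `e_q`-weighted mean,
`∫ ‖u_q‖_∞ e_q dμ ≤ B 2^{q(3-d)/2} ∫ e_q^{3/2} dμ` (`d = 0`: Bernstein, always true; `d = 3`: Kolmogorov, space filling). -/
def IntermittencyBound (d B : ℝ) (μ : Measure H3) : Prop :=
  ∀ q : ℕ, ∫⁻ u, eLpNorm (shellBlock q u) ⊤ volume * ENNReal.ofReal (shellEnergy q u) ∂μ ≤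
    ENNReal.ofReal (B * (2 : ℝ) ^ ((3 - d) / 2 * q)) * ∫⁻ u, ENNReal.ofReal (shellEnergy q u ^ (3 / 2 : ℝ)) ∂μ

/-- **Corollary (spatial sufficient condition).** Intermittency dimension `d > 1` in the weighted mean, N-uniformly, forces
`F_q ≤ C(R, D/ν, B) 2^{q(1-d)/2}` from the energy class alone (`∫ e_q^{3/2} ≤ R ∫ e_q ≤ R 2^{-2q} E‖∇u‖²/(4π²)`), hence
N-uniform resolution by `MeanFluxLocality`: a leak needs sub-filamentary (`d ≤ 1`) bursts. -/
def FilamentThreshold : Prop :=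
  ∀ f : T3 → R3, Torus.IsSmooth f → Torus.IsDivFree f → Torus.HasZeroMean f →
    ∀ ν R d B : ℝ, 0 < ν → 1 < d → 0 ≤ B → ∃ κ : ℕ → ℕ,
      ∀ (N : ℕ) (μ : Measure H3), IsInvariantLevelLaw ν f N R μ → IntermittencyBound d B μ → ResClause κ μ

/-- Composition shape of line B. -/
def LineShapeB : Prop := MomentClosure → FluxLocalityResolution → LoudShellDecay → UniformResolution

/-- Transfer (Card B, spatial currency): some loud invariant family is super-filamentary, `d > 1`, N-uniformly. -/
def LoudUnsaturated : Prop :=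
  ∀ f : T3 → R3, Torus.IsSmooth f → Torus.IsDivFree f → Torus.HasZeroMean f →
    ∀ (ν : ℕ → ℝ) (E ε : ℝ), (∀ j, 0 < ν j) → Tendsto ν atTop (𝓝 0) → 0 < ε →
      (∀ j : ℕ, ∃ R : ℝ, ∃ᶠ N in atTop, ∃ μ : Measure H3, IsInvariantLevelLaw (ν j) f N R μ ∧
          Torus.ensembleEnergy μ ≤ E ∧ ε ≤ Torus.ensembleDissipation (ν j) μ) →
      ∃ E' ε' : ℝ, 0 < ε' ∧ ∀ j : ℕ, ∃ (R d B : ℝ), 1 < d ∧ 0 ≤ B ∧ ∃ᶠ N in atTop, ∃ μ : Measure H3,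
        IsInvariantLevelLaw (ν j) f N R μ ∧ IntermittencyBound d B μ ∧
          Torus.ensembleEnergy μ ≤ E' ∧ ε' ≤ Torus.ensembleDissipation (ν j) μ

/-- Composition shape of line B in the spatial currency. -/
def LineShapeB' : Prop := MomentClosure → MeanFluxLocality → FilamentThreshold → LoudUnsaturated → UniformResolution

end Summit.AnomalousDissipation.AnomalousDissipation.Cruxes.UniformResolution.IdeateOne

end
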